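import Summits.CriticalPhenomena.PercolationContinuityZ3.Theorems.Transplant.TranslationInvariantSlabs
import Summits.CriticalPhenomena.PercolationContinuityZ3.Theorems.Transplant.Z3NetPeriodicFilms
import HarnessLib

/-!
# SUB-PERIODIC INDUCED SUBGRAPHS of graphs on `ℤ^d` die at their own critical points: the MASTER LEMMA behind the lane's slab / film rows —
# every CONNECTED induced subgraph `G[F]` of a locally finite graph `G` on `ℤ^d` invariant under an INJECTED `ℤ^e` (`e ≥ 2`) of translations,
# on a vertex set `F` stable under that `ℤ^e` with finitely many orbits, has `p_c < 1` and `θ_x(p_c) = 0` at every vertex;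
# instance: the FILMS `{0 ≤ x_i ≤ k}` orthogonal to ANY axis `i` of every translation-invariant graph on `ℤ^d`, `d ≥ 3`

builds on p205010 (kernel theorem, internal audit signed; external expert review pending).  Lane `prim-bschramm`, seat `prim-bschramm-stmt`
gen 37 (statements seat; by-name customer of the rung-Q node; lead g24 GO 2026-08-27T23:59Z); helper file (`--supports stmt-CriticalPhenomena-4575
--as helper`); PROOFS ONLY (def-free).

THE POINT.  The lane closed its periodic slab and film rows one carrier at a time, each time re-building a free `ℤ²`- or `ℤ^{d-1}`-action on a
subtype by hand and feeding the rung-Q node («SkelFrmQuasiProxHoldsAll» p553137) through «SkeletonFrmQuasiCustomersHolds» §`AutChart.conj4_zTwoPeriodic_holds`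
/ `conj4_zdPeriodic_holds`: the `(001)`-films of Kesten-periodic nets on `ℤ³` («Z3NetPeriodicFilms» p573626), the `(001)`-slabs of the unit-range cubic
lattices (TARGET 2u, «Z3UnitGensSlabAll» p571396), the slabs `{0 ≤ x₀ ≤ k}` of translation-invariant graphs on `ℤ^d` («TranslationInvariantSlabs» p587615).
This file states the common content ONCE, in Kesten's generality (periodic subgraphs of periodic graphs):
**`TransInv.induce_conj4_of_subperiodic`** — data: a locally finite graph `G` on `Site d = ℤ^d`; an injective additive map `φ : ℤ^e →+ ℤ^d` (`e ≥ 2`)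
under whose image `G` is invariant (`G.Adj (x + φ a) (y + φ a) ↔ G.Adj x y` — invariance under the SUBLATTICE `φ(ℤ^e)` only, so Kesten-periodic
carriers such as `Z3Net` graphs are covered, not only fully translation-invariant ones); a vertex set `F ⊆ ℤ^d` stable under `+ φ a`; a FINITE set
`R ⊆ F` of orbit representatives (`∀ w ∈ F, ∃ a, ∃ r ∈ R, r + φ a = w`); `G[F]` connected.  Conclusion: **`p_c(x) < 1` and `θ_x(p_c(x)) = 0` at every
vertex `x` of `G[F]`**, at `G[F]`'s OWN critical point — by `AutChart.conj4_zdPeriodic_holds he` for the proof-local action `y ↦ y + φ a` of `ℤ^e` on `F`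
(by automorphisms from the sublattice invariance, free from the injectivity of `φ`).  Every further periodic film / slab / tube / diagonal-film row of a
periodic graph on `ℤ^d` is now ONE instantiation (exhibit `φ`, `R`, connectedness).
INSTANCE (new row): **`TransInv.axisFilm_conj4_holds (hd : 3 ≤ d) (G) (hT) (i : Fin d) (k) (hc) (x)`** — the film `{x | 0 ≤ x_i ≤ k}` orthogonal to ANY
coordinate axis `i` of every locally finite, fully translation-invariant graph on `ℤ^d`, `d ≥ 3`, modulo film-connectedness (`φ = Fin.insertNth i 0`, the
coordinate hyperplane `{x_i = 0} ≅ ℤ^{d-1}`; `R = {t e_i : 0 ≤ t ≤ k}`).  For `i = 0` this is p587615's slab row (the tree's `slab d k`; regression `example`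
below); for an ASYMMETRIC `G` the `x_i`-film is not an `x₀`-slab of the same `G`, so the row is not a restatement.  REGRESSION (no new declarations): the
slab row of p587615 and the `ℤ³` film umbrella `Z3Net.film_conj4_of_periodic` of p573626 are re-derived from the master lemma.
Connectedness stays a HYPOTHESIS throughout (NECESSARY as stated: periodic films can be disconnected — the two-layer diamond film
«DiamondFilmOwnCriticalContinuityOneFalse» p563640; the step set `{±2e₀, ±e₁, …}`).  PRINT STATUS (FRESHNESS wording): in print only `ℤ² × {0,…,k}` and
`ℤ² × G₀`, `G₀` finite (Duminil-Copin–Sidoravicius–Tassion 2016, "Two generalizations"); nothing found in print for periodic films / slabs of rank `≥ 3` or of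
long-range periodic graphs; nearest-neighbour `ℤ^d`'s own `θ(p_c) = 0` (`d ≥ 3`) is the lane's KERNEL THEOREM p205010 (internal audit signed; external
expert review pending), NOT in print.  Not a `@[conjecture]` node of the tree.  Nothing is claimed at the ambient graph's critical point, nor about Conj. 4
beyond these periodic instances, nor about the end state.
[cite: Kesten1982, §2.1 Def. 1 and Ch. 3 (periodic graphs)] [cite: BenjaminiSchramm1996, Conj. 4; §2 (almost transitive graphs)]
[cite: DuminilCopinSidoraviciusTassion2016, Thm. 1 + p. 3 "Two generalizations"] [cite: GrimmettPercolation1999, §7.2 p. 148 (`p_c(A)` of an induced subgraph)]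
[cite: KozmaNitzan2024, Thm. 6 (p. 15)]
-/

noncomputable section

namespace Summit.CriticalPhenomena.PercolationContinuityZ3.Theorems

namespace Transplant

open SimpleGraph Literature.Probability.LatticeModels Literature.Probability.Percolation
open scoped Classical

namespace TransInv

variable {d e : ℕ} (G : SimpleGraph (Site d))

/-- **MASTER LEMMA — every connected SUB-PERIODIC induced subgraph of a graph on `ℤ^d` has `p_c < 1` and dies at its own critical point.**
`G` locally finite on `ℤ^d`, invariant under the injected sublattice `φ(ℤ^e)` (`φ : ℤ^e →+ ℤ^d` injective, `e ≥ 2`); `F` stable under `+ φ a` with a finite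
set `R ⊆ F` of orbit representatives; `G[F]` connected.  Then `p_c(x) < 1 ∧ θ_x(p_c(x)) = 0` at every vertex `x` of `G[F]` — the rung-Q node via
`AutChart.conj4_zdPeriodic_holds he` for the proof-local free action `y ↦ y + φ a` of `ℤ^e` on `F`. builds on p205010 (kernel theorem, internal audit
signed; external expert review pending). [cite: Kesten1982, §2.1 Def. 1; Ch. 3] [cite: BenjaminiSchramm1996, Conj. 4; §2] -/
theorem induce_conj4_of_subperiodic (he : 2 ≤ e) [G.LocallyFinite] (φ : Site e →+ Site d) (hφ : Function.Injective φ)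
    (hT : ∀ (a : Site e) (x y : Site d), G.Adj (x + φ a) (y + φ a) ↔ G.Adj x y)
    {F : Set (Site d)} (hF : ∀ (a : Site e) (x : Site d), x ∈ F → x + φ a ∈ F)
    {R : Set (Site d)} (hR : R.Finite) (hRF : R ⊆ F) (hcover : ∀ w ∈ F, ∃ a : Site e, ∃ r ∈ R, r + φ a = w)
    (hc : (G.induce F).Connected) (x : F) :
    criticalProb (G.induce F) x < 1 ∧ theta (G.induce F) x (criticalProbIOf (G.induce F) x) = 0 := by
  -- the `ℤ^e`-action through `φ` (a local instance on the vertex type `F`)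
  letI inst : MulAction (Multiplicative (Site e)) F :=
    { smul := fun a y => ⟨(y : Site d) + φ (Multiplicative.toAdd a), hF _ _ y.2⟩
      one_smul := fun y => Subtype.ext (by
        change (y : Site d) + φ (Multiplicative.toAdd (1 : Multiplicative (Site e))) = y
        rw [toAdd_one, map_zero, add_zero])
      mul_smul := fun a b y => Subtype.ext (by
        change (y : Site d) + φ (Multiplicative.toAdd (a * b)) =
          ((y : Site d) + φ (Multiplicative.toAdd b)) + φ (Multiplicative.toAdd a)
        rw [toAdd_mul, map_add, add_assoc, add_comm (φ _) (φ _)]) }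
  have hcoe : ∀ (a : Multiplicative (Site e)) (y : F),
      ((a • y : F) : Site d) = (y : Site d) + φ (Multiplicative.toAdd a) := fun _ _ => rfl
  -- by automorphisms
  have hact : IsActionByAut (G.induce F) (Multiplicative (Site e)) := by
    intro a y z
    change G.Adj ((y : Site d) + _) ((z : Site d) + _) ↔ G.Adj (y : Site d) (z : Site d)
    exact hT _ _ _
  -- free
  have hfree : ∀ (a : Multiplicative (Site e)) (y : F), a • y = y → a = 1 := by
    intro a y hy
    have h' : (y : Site d) + φ (Multiplicative.toAdd a) = y := by
      rw [← hcoe]; exact congrArg Subtype.val hy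
    rw [add_eq_left, ← map_zero φ] at h'
    exact Multiplicative.toAdd.injective (by rw [toAdd_one]; exact hφ h')
  -- finitely many orbits
  have hcover' : ∀ w : F, ∃ a : Multiplicative (Site e), ∃ r ∈ hR.toFinset.subtype (· ∈ F), a • r = w := by
    intro w
    obtain ⟨a, r, hr, hw⟩ := hcover w w.2
    refine ⟨Multiplicative.ofAdd a, ⟨r, hRF hr⟩, ?_, ?_⟩
    · rw [Finset.mem_subtype, Set.Finite.mem_toFinset]; exact hr
    · exact Subtype.ext (by rw [hcoe, toAdd_ofAdd]; exact hw)
  exact AutChart.conj4_zdPeriodic_holds he hact hfree hc _ hcover' x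

/-- **Every CONNECTED film `{0 ≤ x_i ≤ k}` orthogonal to ANY axis `i` of every locally finite, translation-invariant graph on `ℤ^d`, `d ≥ 3`, has
`p_c < 1` and dies at its own critical point, at every vertex** — the master lemma with `φ = Fin.insertNth i 0` (the hyperplane `{x_i = 0} ≅ ℤ^{d-1}`) and
`R = {t e_i : 0 ≤ t ≤ k}`.  For `i = 0` the film is the tree's slab `slab d k` (p587615's `TransInv.slab_conj4_holds`); any range, no symmetry;
film-connectedness is a hypothesis. builds on p205010 (kernel theorem, internal audit signed; external expert review pending).
[cite: BenjaminiSchramm1996, Conj. 4; §2] [cite: Kesten1982, Ch. 3 (periodic graphs)] [cite: DuminilCopinSidoraviciusTassion2016, Thm. 1] -/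
theorem axisFilm_conj4_holds (hd : 3 ≤ d) [G.LocallyFinite] (hT : ∀ v x y : Site d, G.Adj (x + v) (y + v) ↔ G.Adj x y)
    (i : Fin d) (k : ℕ) (hc : (G.induce {x : Site d | 0 ≤ x i ∧ x i ≤ k}).Connected) (x : {x : Site d | 0 ≤ x i ∧ x i ≤ k}) :
    criticalProb (G.induce {x : Site d | 0 ≤ x i ∧ x i ≤ k}) x < 1 ∧
      theta (G.induce {x : Site d | 0 ≤ x i ∧ x i ≤ k}) x (criticalProbIOf (G.induce {x : Site d | 0 ≤ x i ∧ x i ≤ k}) x) = 0 := by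
  obtain ⟨e, rfl⟩ : ∃ e, d = e + 1 := ⟨d - 1, by omega⟩
  have he : 2 ≤ e := by omega
  -- the embedding of `ℤ^e` as the coordinate hyperplane `{x_i = 0}`
  let φ : Site e →+ Site (e + 1) :=
    { toFun := fun a => Fin.insertNth (α := fun _ => ℤ) i 0 a
      map_zero' := by
        funext j
        rcases Fin.eq_self_or_eq_succAbove i j with rfl | ⟨j', rfl⟩
        · simp [Fin.insertNth_apply_same]
        · simp [Fin.insertNth_apply_succAbove]
      map_add' := fun a b => by
        funext j
        rcases Fin.eq_self_or_eq_succAbove i j with rfl | ⟨j', rfl⟩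
        · simp [Fin.insertNth_apply_same]
        · simp [Fin.insertNth_apply_succAbove] }
  have hφi : ∀ a : Site e, φ a i = 0 := fun a => by
    change Fin.insertNth (α := fun _ => ℤ) i 0 a i = 0
    exact Fin.insertNth_apply_same (α := fun _ => ℤ) i 0 a
  have hφs : ∀ (a : Site e) (j : Fin e), φ a (i.succAbove j) = a j := fun a j => by
    change Fin.insertNth (α := fun _ => ℤ) i 0 a (i.succAbove j) = a j
    exact Fin.insertNth_apply_succAbove (α := fun _ => ℤ) i 0 a j
  have hφ : Function.Injective φ := fun a b h => by
    funext j; rw [← hφs a j, ← hφs b j, h]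
  refine induce_conj4_of_subperiodic G he φ hφ (fun a x y => hT (φ a) x y) (F := {x : Site (e + 1) | 0 ≤ x i ∧ x i ≤ k}) ?_
    (R := ↑((Finset.range (k + 1)).image fun t : ℕ => (Pi.single i (t : ℤ) : Site (e + 1))))
    (Finset.finite_toSet _) ?_ ?_ hc x
  · intro a y hy
    simp only [Set.mem_setOf_eq, Pi.add_apply, hφi, add_zero] at hy ⊢
    exact hy
  · intro r hr
    rw [Finset.mem_coe, Finset.mem_image] at hr
    obtain ⟨t, ht, rfl⟩ := hr
    rw [Finset.mem_range] at ht
    simp only [Set.mem_setOf_eq, Pi.single_eq_same]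
    constructor <;> omega
  · intro w hw
    rw [Set.mem_setOf_eq] at hw
    refine ⟨Fin.removeNth i w, Pi.single i (w i), ?_, ?_⟩
    · rw [Finset.mem_coe, Finset.mem_image]
      refine ⟨(w i).toNat, Finset.mem_range.2 (by omega), ?_⟩
      rw [Int.toNat_of_nonneg hw.1]
    · funext j
      rcases Fin.eq_self_or_eq_succAbove i j with rfl | ⟨j', rfl⟩
      · rw [Pi.add_apply, hφi, Pi.single_eq_same, add_zero]
      · rw [Pi.add_apply, hφs, Pi.single_eq_of_ne (Fin.succAbove_ne i j'), zero_add]; rfl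

/-- Regression (no new declaration): the axis film for `i = 0` is the tree's slab `slab d k`, and the master lemma re-derives
«TranslationInvariantSlabs»' `TransInv.slab_conj4_holds` (p587615). -/
example [NeZero d] (hd : 3 ≤ d) [G.LocallyFinite] (hT : ∀ v x y : Site d, G.Adj (x + v) (y + v) ↔ G.Adj x y) (k : ℕ)
    (hc : (G.induce (slab d k)).Connected) (x : slab d k) :
    criticalProb (G.induce (slab d k)) x < 1 ∧ theta (G.induce (slab d k)) x (criticalProbIOf (G.induce (slab d k)) x) = 0 :=
  axisFilm_conj4_holds G hd hT 0 k hc x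

end TransInv

/-! ## Regression: the `ℤ³` film umbrella «Z3NetPeriodicFilms» is an instance of the master lemma -/

namespace Z3Net

/-- Regression (no new declaration): `Z3Net.film_conj4_of_periodic` (p573626) re-derived from `TransInv.induce_conj4_of_subperiodic` with
`φ a = (n₀ a₀, n₁ a₁, 0)` (the horizontal period lattice), `F = film a b`, `R` = the film base `[0,n₀) × [0,n₁) × [a,b]`. -/
example (N : Z3Net) {n : Fin 3 → ℕ} (h : N.Periodic n) (hn : ∀ i, 0 < n i) (a b : ℤ)
    (hc : (N.graph.induce (film a b)).Connected) (v : film a b) :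
    criticalProb (N.graph.induce (film a b)) v < 1 ∧
      theta (N.graph.induce (film a b)) v (criticalProbIOf (N.graph.induce (film a b)) v) = 0 := by
  let φ : Site 2 →+ Site 3 :=
    { toFun := fun a' => ![(n 0 : ℤ) * a' 0, (n 1 : ℤ) * a' 1, 0]
      map_zero' := by funext i; fin_cases i <;> simp
      map_add' := fun a' b' => by funext i; fin_cases i <;> simp [mul_add] }
  have hφapp : ∀ a', φ a' = ![(n 0 : ℤ) * a' 0, (n 1 : ℤ) * a' 1, 0] := fun _ => rfl
  have hφ : Function.Injective φ := fun a' b' hab => by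
    have h0 := congrFun hab 0
    have h1 := congrFun hab 1
    simp only [hφapp, Matrix.cons_val_zero, Matrix.cons_val_one] at h0 h1
    funext i; fin_cases i
    · exact mul_left_cancel₀ (by exact_mod_cast (hn 0).ne') h0
    · exact mul_left_cancel₀ (by exact_mod_cast (hn 1).ne') h1
  have hmemL : ∀ a' : Site 2, φ a' ∈ periodLattice n := by
    intro a' i; rw [hφapp]; fin_cases i
    · exact dvd_mul_right _ _
    · exact dvd_mul_right _ _
    · simp
  have hT : ∀ (a' : Site 2) (x y : Site 3), N.graph.Adj (x + φ a') (y + φ a') ↔ N.graph.Adj x y := fun a' x y =>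
    ⟨fun hxy => by
      have := N.adj_add_right h (neg_mem_periodLattice (hmemL a')) hxy
      rwa [add_neg_cancel_right, add_neg_cancel_right] at this, N.adj_add_right h (hmemL a')⟩
  have hF : ∀ (a' : Site 2) (x : Site 3), x ∈ film a b → x + φ a' ∈ film a b := by
    intro a' x hx
    rw [mem_film] at hx ⊢; rw [hφapp]; simpa using hx
  refine TransInv.induce_conj4_of_subperiodic N.graph le_rfl φ hφ hT hF
    (R := Subtype.val '' {v : film a b | 0 ≤ (v : Site 3) 0 ∧ (v : Site 3) 0 < n 0 ∧ 0 ≤ (v : Site 3) 1 ∧ (v : Site 3) 1 < n 1})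
    ((finite_filmBase n a b).image _) ?_ ?_ hc v
  · rintro _ ⟨w, -, rfl⟩; exact w.2
  · intro w hw
    refine ⟨![w 0 / (n 0 : ℤ), w 1 / (n 1 : ℤ)], _, ⟨⟨_, hres_mem_film n hw⟩, ?_, rfl⟩, ?_⟩
    · have h0 := hn 0
      have h1 := hn 1
      simp only [Set.mem_setOf_eq, Matrix.cons_val_zero, Matrix.cons_val_one]
      exact ⟨Int.emod_nonneg _ (by exact_mod_cast h0.ne'), Int.emod_lt_of_pos _ (by exact_mod_cast h0),
        Int.emod_nonneg _ (by exact_mod_cast h1.ne'), Int.emod_lt_of_pos _ (by exact_mod_cast h1)⟩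
    · rw [hφapp]; funext i; fin_cases i
      · simp; linarith [Int.emod_add_mul_ediv (w 0) (n 0 : ℤ)]
      · simp; linarith [Int.emod_add_mul_ediv (w 1) (n 1 : ℤ)]
      · simp

end Z3Net

end Transplant

end Summit.CriticalPhenomena.PercolationContinuityZ3.Theorems

end
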